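import Literature.Topology.PlaneTopology.Schoenflies
import Literature.Probability.RandomPlanarGeometry.ArcHullDomains
import Mathlib.MeasureTheory.Measure.Lebesgue.Basic
import Mathlib.Analysis.Normed.Module.Convex
import HarnessLib

/-!
# Radó squeezes, part 7: three auxiliary lemmas (sub-loops of Jordan curves, diameters, disjoint intervals)

Support file (`--supports stmt-CriticalPhenomena-0773`, towards the registered stub `stub_radoSqueezeFamily`,
geometry F′ of the line `birth` for the crux `RestrictionOfLimit`). Pure topology / real analysis.

* `range_eq_of_range_subset_loop` — **a Jordan curve contains no proper Jordan sub-curve**: if `γ` and `b` are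
  continuous `1`-periodic loops injective on a period and `range γ ⊆ range b`, then `range γ = range b`. Proof:
  a missed point `b u₀` turns `b` into a homeomorphism of a compact interval onto a set containing `range γ`,
  and `b⁻¹ ∘ γ` would be a continuous periodic real function injective on a period, which is absurd (it has
  a maximum, around which the intermediate value theorem produces a repeated value).
* `dist_le_diam_frontier` — for a bounded open planar set `U`, every point of `closure U` is within
  `diam (frontier U)` of every frontier point (a point of `U` lies on a segment between two frontier points of
  the horizontal line through it).
* `finite_of_le_length_of_disjoint` — pairwise disjoint open sub-intervals of an interval of length `1`, each
  of length `≥ δ > 0`, are finitely many (Lebesgue measure).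

Axioms `propext`, `Classical.choice`, `Quot.sound`.
-/

noncomputable section

open Set Filter Topology Metric Function
open Literature.Topology.PlaneTopology

namespace Summit.CriticalPhenomena.SAWScalingLimit.Theorems.RestrictionOfLimit.Birth

/-! ### No continuous periodic real function is injective on a period -/

/-- A continuous `1`-periodic real function is not injective on `[0, 1)`. [folklore] -/
theorem not_injOn_of_periodic {f : ℝ → ℝ} (hf : Continuous f) (hp : Periodic f 1) : ¬ InjOn f (Ico 0 1) := by
  intro hinj
  -- a global maximum
  obtain ⟨m, -, hmax⟩ := isCompact_Icc.exists_isMaxOn (nonempty_Icc.2 zero_le_one) hf.continuousOn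
  have hle : ∀ θ, f θ ≤ f m := fun θ ↦ by
    have h : f (Int.fract θ) ≤ f m := hmax ⟨Int.fract_nonneg θ, (Int.fract_lt_one θ).le⟩
    rwa [show f (Int.fract θ) = f θ from hp.map_fract θ] at h
  have hinj' : InjOn f (Ico (m - 1 / 4) (m - 1 / 4 + 1)) := by
    intro s hs t ht hst
    have hs' : s - (m - 1 / 4) ∈ Ico (0 : ℝ) 1 := ⟨by linarith [hs.1], by linarith [hs.2]⟩
    have ht' : t - (m - 1 / 4) ∈ Ico (0 : ℝ) 1 := ⟨by linarith [ht.1], by linarith [ht.2]⟩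
    have h := hp.injOn_shift hinj (m - 1 / 4) hs' ht' (by simp only [sub_add_cancel]; exact hst)
    linarith
  have h1 := hle (m - 1 / 4)
  have h2 := hle (m + 1 / 4)
  rcases le_total (f (m - 1 / 4)) (f (m + 1 / 4)) with h | h
  · -- the value `f (m + 1/4)` is taken on `[m - 1/4, m]`
    obtain ⟨ξ, hξ, hfξ⟩ : f (m + 1 / 4) ∈ f '' Icc (m - 1 / 4) m :=
      intermediate_value_Icc (by linarith) hf.continuousOn ⟨h, h2⟩
    have := hinj' ⟨hξ.1, by linarith [hξ.2]⟩ ⟨by linarith, by linarith⟩ hfξ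
    linarith [hξ.2]
  · -- the value `f (m - 1/4)` is taken on `[m, m + 1/4]`
    obtain ⟨ξ, hξ, hfξ⟩ : f (m - 1 / 4) ∈ f '' Icc m (m + 1 / 4) :=
      intermediate_value_Icc' (by linarith) hf.continuousOn ⟨h, h1⟩
    have := hinj' ⟨by linarith [hξ.1], by linarith [hξ.2]⟩ ⟨le_rfl, by linarith⟩ hfξ
    linarith [hξ.1]

/-! ### A Jordan curve contains no proper Jordan sub-curve -/

/-- **A simple loop whose range lies in the range of another simple loop fills it.** [folklore] -/
theorem range_eq_of_range_subset_loop {b γ : ℝ → ℂ} (hb : Continuous b) (hbp : Periodic b 1)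
    (hbi : InjOn b (Ico 0 1)) (hγ : Continuous γ) (hγp : Periodic γ 1) (hγi : InjOn γ (Ico 0 1))
    (h : range γ ⊆ range b) : range γ = range b := by
  refine h.antisymm fun x₀ hx₀ ↦ ?_
  by_contra hx₀γ
  obtain ⟨u₀, rfl⟩ := hx₀
  -- shift `b` to start at the missed point
  set b' : ℝ → ℂ := fun s ↦ b (s + u₀) with hb'
  have hb'c : Continuous b' := hb.comp (continuous_id.add continuous_const)
  have hb'p : Periodic b' 1 := fun s ↦ by
    show b (s + 1 + u₀) = b (s + u₀)
    rw [add_right_comm]; exact hbp (s + u₀)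
  have hb'i : InjOn b' (Ico 0 1) := hbp.injOn_shift hbi u₀
  have hb'0 : b' 0 = b u₀ := by simp [hb']
  -- the closed set of parameters of `[0, 1]` whose image lies on `range γ` avoids `0` and `1`
  have hKc : IsClosed (range γ) := by
    have : range γ = γ '' Icc 0 1 := by
      refine Subset.antisymm ?_ (image_subset_range _ _)
      rintro _ ⟨θ, rfl⟩
      exact ⟨Int.fract θ, ⟨Int.fract_nonneg θ, (Int.fract_lt_one θ).le⟩, hγp.map_fract θ⟩
    rw [this]
    exact (isCompact_Icc.image hγ).isClosed
  have hpre : IsOpen (b' ⁻¹' (range γ)ᶜ) := hKc.isOpen_compl.preimage hb'c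
  have h0mem : (0 : ℝ) ∈ b' ⁻¹' (range γ)ᶜ := by
    show b' 0 ∉ range γ
    rwa [hb'0]
  have h1mem : (1 : ℝ) ∈ b' ⁻¹' (range γ)ᶜ := by
    show b' 1 ∉ range γ
    rw [show b' 1 = b' 0 from by simpa using hb'p 0, hb'0]; exact hx₀γ
  obtain ⟨δ₀, hδ₀, hball₀⟩ := Metric.isOpen_iff.1 hpre 0 h0mem
  obtain ⟨δ₁, hδ₁, hball₁⟩ := Metric.isOpen_iff.1 hpre 1 h1mem
  set δ : ℝ := min (min δ₀ δ₁) (1 / 4) with hδ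
  have hδpos : 0 < δ := lt_min (lt_min hδ₀ hδ₁) (by norm_num)
  have hδle₀ : δ ≤ δ₀ := (min_le_left _ _).trans (min_le_left _ _)
  have hδle₁ : δ ≤ δ₁ := (min_le_left _ _).trans (min_le_right _ _)
  have hδ4 : δ ≤ 1 / 4 := min_le_right _ _
  set J : Set ℝ := Icc δ (1 - δ) with hJ
  -- `range γ ⊆ b' '' J`
  have hsubJ : range γ ⊆ b' '' J := by
    intro y hy
    obtain ⟨s, rfl⟩ := h hy
    have hs : b s = b' (Int.fract (s - u₀)) := by
      rw [hb'p.map_fract]; simp [hb']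
    rw [hs] at hy ⊢
    refine ⟨Int.fract (s - u₀), ⟨?_, ?_⟩, rfl⟩
    · by_contra hlt
      rw [not_le] at hlt
      have : Int.fract (s - u₀) ∈ ball (0 : ℝ) δ₀ := by
        rw [mem_ball_zero_iff, Real.norm_eq_abs, abs_of_nonneg (Int.fract_nonneg _)]
        linarith
      exact hball₀ this hy
    · by_contra hlt
      rw [not_le] at hlt
      have : Int.fract (s - u₀) ∈ ball (1 : ℝ) δ₁ := by
        rw [mem_ball, Real.dist_eq, abs_of_neg (by linarith [Int.fract_lt_one (s - u₀)])]
        linarith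
      exact hball₁ this hy
  -- the inverse of `b'` on `J` is continuous on `b' '' J`
  have hJc : IsCompact J := isCompact_Icc
  have hJsub : J ⊆ Ico 0 1 := fun s hs ↦ ⟨by linarith [hs.1, hδpos], by linarith [hs.2, hδpos]⟩
  have hJi : InjOn b' J := hb'i.mono hJsub
  have hψ : ContinuousOn (invFunOn b' J) (b' '' J) := Schoenflies.continuousOn_invFunOn hJc hb'c.continuousOn hJi
  -- the continuous periodic real function `b'⁻¹ ∘ γ`
  set f : ℝ → ℝ := fun θ ↦ invFunOn b' J (γ θ) with hf
  have hfc : Continuous f := by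
    have : Continuous fun θ ↦ (⟨γ θ, hsubJ ⟨θ, rfl⟩⟩ : b' '' J) := by fun_prop
    exact (hψ.restrict).comp this |>.congr fun θ ↦ rfl
  have hfp : Periodic f 1 := fun θ ↦ by simp [hf, hγp θ]
  have hbf : ∀ θ, b' (f θ) = γ θ := fun θ ↦ by
    obtain ⟨s, hs, hsy⟩ := hsubJ ⟨θ, rfl⟩
    exact invFunOn_eq ⟨s, hs, hsy⟩
  have hfi : InjOn f (Ico 0 1) := fun θ hθ θ' hθ' hff ↦ hγi hθ hθ' (by rw [← hbf θ, ← hbf θ', hff])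
  exact not_injOn_of_periodic hfc hfp hfi

/-! ### Points of a bounded open set lie between two frontier points -/

/-- A segment leaving a set meets its frontier. [folklore] -/
theorem exists_mem_frontier_on_segment {U : Set ℂ} (hU : IsOpen U) {z v : ℂ} (hz : z ∈ U) (hv : z + v ∉ U) :
    ∃ τ ∈ Icc (0 : ℝ) 1, z + (τ : ℂ) * v ∈ frontier U := by
  by_contra hno
  push Not at hno
  set seg : Set ℂ := (fun τ : ℝ ↦ z + (τ : ℂ) * v) '' Icc 0 1 with hseg
  have hsegc : IsPreconnected seg := isPreconnected_Icc.image _ (by fun_prop)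
  have hsub : seg ⊆ U ∪ (closure U)ᶜ := by
    rintro _ ⟨τ, hτ, rfl⟩
    by_cases hcl : z + (τ : ℂ) * v ∈ closure U
    · rw [closure_eq_self_union_frontier] at hcl
      exact Or.inl (hcl.resolve_right (hno τ hτ))
    · exact Or.inr hcl
  have hdisj : Disjoint U (closure U)ᶜ := disjoint_compl_right.mono_left subset_closure
  have hmeet : (seg ∩ U).Nonempty := ⟨z, ⟨0, ⟨le_rfl, zero_le_one⟩, by simp⟩, hz⟩
  have hsegU : seg ⊆ U :=
    hsegc.subset_left_of_subset_union hU isClosed_closure.isOpen_compl hdisj hsub hmeet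
  exact hv (hsegU ⟨1, ⟨zero_le_one, le_rfl⟩, by simp⟩)

/-- **Every point of the closure of a bounded open planar set is within `diam (frontier U)` of every frontier
point.** [folklore] -/
theorem dist_le_diam_frontier {U : Set ℂ} (hU : IsOpen U) (hb : Bornology.IsBounded U) {z q : ℂ}
    (hz : z ∈ closure U) (hq : q ∈ frontier U) : dist z q ≤ diam (frontier U) := by
  have hfb : Bornology.IsBounded (frontier U) := hb.closure.subset frontier_subset_closure
  rw [closure_eq_self_union_frontier] at hz
  rcases hz with hz | hz
  swap; · exact dist_le_diam_of_mem hfb hz hq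
  obtain ⟨R₀, hR₀⟩ := hb.subset_ball 0
  set R : ℝ := |R₀| + ‖z‖ + 1 with hR
  have hout : ∀ w : ℂ, R ≤ ‖w - z‖ → w ∉ U := fun w hw hwU ↦ by
    have h1 : ‖w‖ < R₀ := mem_ball_zero_iff.1 (hR₀ hwU)
    have h2 : ‖w - z‖ ≤ ‖w‖ + ‖z‖ := norm_sub_le w z
    linarith [le_abs_self R₀]
  have hRpos : 0 < R := by rw [hR]; positivity
  have hnormR : ‖(R : ℂ)‖ = R := by rw [Complex.norm_real, Real.norm_of_nonneg hRpos.le]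
  obtain ⟨τ₁, hτ₁, he₁⟩ := exists_mem_frontier_on_segment hU hz (v := R) (hout _ (by simpa using le_abs_self R))
  obtain ⟨τ₂, hτ₂, he₂⟩ :=
    exists_mem_frontier_on_segment hU hz (v := -R) (hout _ (by simpa using le_abs_self R))
  have hUfr : ∀ w ∈ frontier U, w ∉ U := fun w hw hwU ↦ by
    have := hw.2; rw [hU.interior_eq] at this; exact this hwU
  have hτ₁0 : 0 < τ₁ := lt_of_le_of_ne hτ₁.1 fun h ↦ hUfr _ he₁ (by rw [← h]; simpa using hz)
  have hτ₂0 : 0 < τ₂ := lt_of_le_of_ne hτ₂.1 fun h ↦ hUfr _ he₂ (by rw [← h]; simpa using hz)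
  -- `z` lies on the segment between the two frontier points
  set e₁ : ℂ := z + (τ₁ : ℂ) * R
  set e₂ : ℂ := z + (τ₂ : ℂ) * (-R)
  have hzseg : z ∈ segment ℝ e₁ e₂ := by
    refine ⟨τ₂ / (τ₁ + τ₂), τ₁ / (τ₁ + τ₂), by positivity, by positivity, by field_simp; ring, ?_⟩
    have hsum : ((τ₁ : ℂ) + (τ₂ : ℂ)) ≠ 0 := by norm_cast; linarith
    simp only [e₁, e₂, Complex.real_smul]
    push_cast
    field_simp
    ring
  have hconv : ConvexOn ℝ univ fun w : ℂ ↦ dist w q := convexOn_univ_dist q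
  calc dist z q ≤ max (dist e₁ q) (dist e₂ q) := hconv.le_on_segment (mem_univ _) (mem_univ _) hzseg
    _ ≤ diam (frontier U) := max_le (dist_le_diam_of_mem hfb he₁ hq) (dist_le_diam_of_mem hfb he₂ hq)

/-! ### Disjoint long sub-intervals of a unit interval are finitely many -/

/-- **Pairwise disjoint open sub-intervals of `[μ, μ + 1]` of length at least `δ > 0` form a finite family.**
[folklore] -/
theorem finite_of_le_length_of_disjoint {ι : Type*} {S : Set ι} {s t : ι → ℝ} {μ δ : ℝ} (hδ : 0 < δ)
    (hst : ∀ i ∈ S, μ ≤ s i ∧ t i ≤ μ + 1) (hlen : ∀ i ∈ S, δ ≤ t i - s i)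
    (hdisj : S.PairwiseDisjoint fun i ↦ Ioo (s i) (t i)) : S.Finite := by
  by_contra hinf
  obtain ⟨T, hTS, hTcard⟩ := Set.Infinite.exists_subset_card_eq hinf (⌊1 / δ⌋₊ + 1)
  have hmeas : MeasureTheory.volume (⋃ i ∈ T, Ioo (s i) (t i)) = ∑ i ∈ T, ENNReal.ofReal (t i - s i) := by
    rw [MeasureTheory.measure_biUnion_finset (hdisj.subset hTS) fun i _ ↦ measurableSet_Ioo]
    exact Finset.sum_congr rfl fun i _ ↦ Real.volume_Ioo
  have hsub : (⋃ i ∈ T, Ioo (s i) (t i)) ⊆ Icc μ (μ + 1) := by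
    intro y hy
    simp only [mem_iUnion, exists_prop] at hy
    obtain ⟨i, hi, hy⟩ := hy
    exact ⟨(hst i (hTS hi)).1.trans hy.1.le, hy.2.le.trans (hst i (hTS hi)).2⟩
  have hle : ∑ i ∈ T, ENNReal.ofReal (t i - s i) ≤ 1 := by
    rw [← hmeas]
    refine (MeasureTheory.measure_mono hsub).trans ?_
    rw [Real.volume_Icc, add_sub_cancel_left, ENNReal.ofReal_one]
  have hge : (T.card : ENNReal) * ENNReal.ofReal δ ≤ ∑ i ∈ T, ENNReal.ofReal (t i - s i) := by
    rw [← nsmul_eq_mul, ← Finset.sum_const]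
    exact Finset.sum_le_sum fun i hi ↦ ENNReal.ofReal_le_ofReal (hlen i (hTS hi))
  have hreal : (T.card : ℝ) * δ ≤ 1 := by
    have h := hge.trans hle
    rw [← ENNReal.ofReal_natCast, ← ENNReal.ofReal_mul (Nat.cast_nonneg _), ← ENNReal.ofReal_one,
      ENNReal.ofReal_le_ofReal_iff zero_le_one] at h
    exact h
  rw [hTcard] at hreal
  have hfl : (1 / δ : ℝ) < (⌊1 / δ⌋₊ + 1 : ℕ) := by push_cast; exact Nat.lt_floor_add_one _
  have : (1 / δ) * δ < ((⌊1 / δ⌋₊ + 1 : ℕ) : ℝ) * δ := mul_lt_mul_of_pos_right hfl hδ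
  rw [one_div_mul_cancel hδ.ne'] at this
  linarith

/-- **Registered helper stub `stub_radoAux`** (towards `stub_radoSqueezeFamily`, line `birth`): a simple loop
whose range lies in the range of another simple loop fills it, in closed form. [folklore] -/
theorem stub_radoAux :
    ∀ (b γ : ℝ → ℂ), Continuous b → Function.Periodic b 1 → Set.InjOn b (Set.Ico 0 1) → Continuous γ →
      Function.Periodic γ 1 → Set.InjOn γ (Set.Ico 0 1) → Set.range γ ⊆ Set.range b →
      Set.range γ = Set.range b :=
  fun _ _ hb hbp hbi hγ hγp hγi h ↦ range_eq_of_range_subset_loop hb hbp hbi hγ hγp hγi h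

end Summit.CriticalPhenomena.SAWScalingLimit.Theorems.RestrictionOfLimit.Birth

end
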